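/-
Copyright (c) 2026 the pub-hodgecm-mathlib formalisation cell (harness21).  Prover seat hodgecm-mathlib-LH4-p09 (g10) (VALVE hand, LEAD F0P6-plan (g14)
BATCH #88 (4)), Track B «K2-LIT» ∕ hLiu418 #184♮, ROAD Φ, the (K1b-W) cut of K2Liu-p14 (g4) 2026-09-04T22:32:01Z, file (KW1-d): THE DECAY LETTER OF THE
KIND-1 LINE WHITTAKER BLOCK — the archimedean line letter with its rate, the `n = 1` height face, and the `hdec₁` assembly.  THEOREMS ONLY.
-/
import Summits.HodgeConjecture.HodgeConjecture.Theorems.K2LiuSiegelEisensteinKindWDecay         -- ★ `hdec_of_letters` (generic `ι X n N`)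
import Summits.HodgeConjecture.HodgeConjecture.Theorems.K2LiuSiegelEisensteinKindWArchDecay     -- ★ `decay_le_exp_neg_height_of_le` (generic block type `p`) + ★ G7
import Summits.HodgeConjecture.HodgeConjecture.Theorems.K2E1ArchWhittakerDecayUniformU2         -- ★ `exists_forall_norm_Gamma_inv_le`, `re_mem_Icc_of_mem_closedBall`, ★ `norm_mellin_expKernel_le`
import Summits.HodgeConjecture.HodgeConjecture.Theorems.K2LiuRankOneArchWhittakerMirrorTypes    -- ★ W1-arch `archLineWhittaker_eq`, `oddWhittaker_closedForm`, `whittaker_neg_weight_eq_conj` (types `±(2j+1)`)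
import HarnessLib

/-!
# Crux `HLiu418`, KIND 1 (the pulled-back LINE family, `n := 1`), file (KW1-d) `K2LiuKindOneLineWhittakerDecay`: THE DECAY LETTER `hdec₁`

Cell `hodgecm-mathlib`, crux item hLiu418 = `stmt-HodgeConjecture-24832` (helper lane `--supports … --as helper`, count-neutral), route of record
`HCCMUnconditional`; squad K2 ∕ K2Liu, LEAD F0P6-plan (g14); line lead K2Liu-p14 (g4) ((K1b-W) FILE CUT 2026-09-04T22:32:01Z), K1 desk F0P2-p11 (g2).
THEOREMS ONLY (no `def`, no `instance`, no notation, no named-fact hypothesis, no `sorry`).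

THE POINT.  The K1-b♮ assembly consumes, for the `n = 1` Whittaker block `A₁(μ,s,x)` of a pulled-back line family, the height-form Gaussian DECAY
letter in the bytes of ★ `K2LiuKindOneWeightsOfDecay.kindOne_weights_of_decay` (`hdecb`, read at `n := 1`):
`∀ z, 0 < re z → ∃ C a c a′ r, … ∀ μ s, dist s z < r → ∀ x, ‖A₁ μ s x‖ ≤ C·H(x)^a·(e^{−c·H(x)^{−a′}·τ₁ μ}·(1 + τ₁ μ)^{N})`, `H = adelicHeightGL (1+1) L ↑x`.
Exactly as for KIND W, it is assembled from three conversions, two of which are ★ and GENERIC and are only READ here at `n = 1`: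
* §1 **the archimedean LINE letter with its rate** (new): the closed form of the rank-one archimedean Whittaker integral of the scalar type
  (★ `K2LiuRankOneArchWhittakerCentre.archLineWhittaker_eq`, ★ `…EvenHolomorphy.oddWhittaker_closedForm`)
  `CF(s,h) = Γ(s+1)⁻¹·√π·(−iπh·𝓜[K_h](s−½) − i·𝓜[K_h](s+½))`, `K_h(t) = e^{−t−π²h²∕t}`, obeys
  `‖CF(s,h)‖ ≤ C·(1 + |h|)·e^{−π|h|}` for `s` near any `z₀` with `re z₀ > ½` and ALL real `h` (★ `K2E1ArchWhittakerContinuation.norm_mellin_expKernel_le`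
  twice — at `z := s` and `z := s + 1` — and `Γ⁻¹` bounded on the closed disc, ★ `exists_forall_norm_Gamma_inv_le`); rate `π` EXPOSED
  (`norm_archLineClosedForm_le_of_re_mem_Icc`, **`exists_forall_norm_archLineClosedForm_le`**); hence the scalar-type LINE Whittaker integrals
  `∫_ℝ f⁰_{s,k}(J·n(β)) e^{−2πihβ} dβ` themselves, `k : ℤ` the archimedean type BY VALUE: `k = 1` (`exists_forall_norm_archLineWhittaker_le`, ★ `archLineWhittaker_eq`),
  `k = −1` (`…_neg_le`, ★ `whittaker_neg_weight_eq_conj`), odd `k = ±(2j+1)` with the EVEN integrals `V_{m+1}` (`m < j`) kept BY VALUE as an additive term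
  (`exists_forall_norm_oddWhittaker_le`, `…_neg_le`, ★ `oddWhittaker_closedForm`).
* §2 **the `n = 1` height face** (★ `K2LiuSiegelEisensteinKindWArchDecay.decay_le_exp_neg_height_of_le` READ at block type `p := Fin 1`, scalar currency):
  for `H₁ = U(J₁)`, `J₁ ∈ M_2(E)`, complex places `w σ`, frames and movers with entries `≤ M` and ANY Iwasawa block decomposition with (1×1) corner `y σ`,
  and non-negative reals `t σ` (read `t σ = ½|μ|_σ`): `∏_σ e^{−2π t_σ ‖y_σ‖²} ≤ e^{−c₁ ‖h‖^{−2} τ}` for every `τ ≤ Σ_σ t_σ`, AND the polynomial face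
  `∏_σ (1 + t_σ ‖y_σ‖²)^k ≤ C₂^k ‖h‖^{2·#S·k} (1 + Σ_σ t_σ)^{#S·k}` (★ G7-B `block_entry_bounds`) — **`lineDecay_le_exp_neg_height`**, **`prod_one_add_mul_normSq_pow_le_height`**.
* §3 **`hdec₁_of_letters`** (★ `K2LiuSiegelEisensteinKindWDecay.hdec_of_letters` READ at `n := 1`, `N := 1 + 1`): for 1×1 indices `mat μ` the determinant IS the entry,
  so the defect reads `∏_{w∣∞} (1 + |mat μ 0 0|_w⁻¹)^{N′}` and `hdet0` reads `mat μ 0 0 = 0 → A μ s x = 0`; with the support letter `hsupp₁` ((KW1-c)) the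
  height-currency local letter `hloc₁` gives the `hdec₁` bytes VERBATIM (`N_W = N₁ + [L:ℚ]·N′·#{w∣∞}`).
WHAT IS NOT HERE: the `h`-decay of the EVEN integrals `V_m` (types `|k| ≥ 3`; ★ holomorphy only) — an edition 2 item if the pulled-back family carries such
types at `∞`; the Iwasawa-point reading of the local Whittaker function (line lead's (KW1-b) per-place presentation); the finite-place polynomial letter.
References: [Bump1997] §1.6, §3.7; [Garrett2018] §1.10; [MoeglinWaldspurger1995] I.2.2, II.1.5, II.1.7, IV.1.9; [Shimura1997] §18.4 Prop. 18.14, §A3; [BorelJacquet1979] §1.2.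
HONEST LABEL.  Count-neutral helper, hypothesis-first where it assembles; closes no socket: `HC_CM` is proved only modulo the 7 printed citations (2 remaining
named inputs: hLiu418 = `stmt-HodgeConjecture-24832`, h413 = `stmt-HodgeConjecture-24833`) until rung 0 closes.
-/

set_option autoImplicit false
set_option linter.dupNamespace false -- the mandated namespace repeats `HodgeConjecture.HodgeConjecture`

noncomputable section

namespace Summit.HodgeConjecture.HodgeConjecture.Cruxes.HLiu418.K2LiuKindOneLineWhittakerDecay

open MeasureTheory Set Filter Topology
open scoped BigOperators

open Summit.HodgeConjecture.HodgeConjecture.Cruxes.H413.K2E1ArchWhittakerContinuation (norm_mellin_expKernel_le)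
open Summit.HodgeConjecture.HodgeConjecture.Cruxes.H413.K2E1ArchWhittakerDecayUniformU2 (exists_forall_norm_Gamma_inv_le re_mem_Icc_of_mem_closedBall
  setIntegral_stripMajorant_nonneg)
open Summit.HodgeConjecture.HodgeConjecture.Cruxes.HLiu418.K2LiuArchInducedTubeDefs (archScalarSection)
open Summit.HodgeConjecture.HodgeConjecture.Cruxes.HLiu418.K2LiuRankOneArchWhittakerCentre (archLineWhittaker_eq)
open Summit.HodgeConjecture.HodgeConjecture.Cruxes.HLiu418.K2LiuRankOneArchWhittakerEvenHolomorphy (oddWhittaker_closedForm)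
open Summit.HodgeConjecture.HodgeConjecture.Cruxes.HLiu418.K2LiuRankOneArchWhittakerMirrorTypes (whittaker_neg_weight_eq_conj)
open scoped ComplexConjugate

/-! ## §1 The archimedean LINE letter with its rate `π` -/

section ArchLine

/-- `√(π²h²) = π·|h|` — the decay exponent `√A` of ★ `norm_mellin_expKernel_le` at `A = π²h²`. [folklore] -/
theorem sqrt_pi_sq_mul_sq (h : ℝ) : Real.sqrt (Real.pi ^ 2 * h ^ 2) = Real.pi * |h| := by
  rw [show Real.pi ^ 2 * h ^ 2 = (Real.pi * h) ^ 2 by ring, Real.sqrt_sq_eq_abs, abs_mul, abs_of_pos Real.pi_pos]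

/-- **STRIP BOUND FOR THE LINE CLOSED FORM**: for `½ < x₀ ≤ re s ≤ x₁` and every real `h`,
`‖Γ(s+1)⁻¹·√π·(−iπh·𝓜[K_h](s−½) − i·𝓜[K_h](s+½))‖ ≤ ‖Γ(s+1)⁻¹‖·√π·I(x₀,x₁+1)·(π|h| + 1)·e^{−π|h|}`, `I` the strip constant of
★ `norm_mellin_expKernel_le` (used at `z := s` and at `z := s + 1`, `A = π²h²`, `√A = π|h|`). [cite: Bump1997, §1.6, §3.7] [cite: Garrett2018, §1.10] -/
theorem norm_archLineClosedForm_le_of_re_mem_Icc {x₀ x₁ : ℝ} (hx₀ : 1 / 2 < x₀) {s : ℂ} (h₀ : x₀ ≤ s.re) (h₁ : s.re ≤ x₁) (h : ℝ) :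
    ‖(Complex.Gamma (s + 1))⁻¹ * ((Real.sqrt Real.pi : ℝ) : ℂ) *
        (-(Real.pi * Complex.I * h) * mellin (fun t : ℝ => Complex.exp (-(t : ℂ) - ((Real.pi ^ 2 * h ^ 2 : ℝ) : ℂ) / (t : ℂ))) (s - 1 / 2) -
          Complex.I * mellin (fun t : ℝ => Complex.exp (-(t : ℂ) - ((Real.pi ^ 2 * h ^ 2 : ℝ) : ℂ) / (t : ℂ))) (s + 1 / 2))‖ ≤
      ‖(Complex.Gamma (s + 1))⁻¹‖ * Real.sqrt Real.pi *
        (∫ u in Ioi (0 : ℝ), (u ^ (x₀ - 3 / 2) + u ^ (x₁ + 1 - 3 / 2)) * Real.exp (-(3 / 4 * u))) * (Real.pi * |h| + 1) * Real.exp (-(Real.pi * |h|)) := by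
  set I₀ : ℝ := ∫ u in Ioi (0 : ℝ), (u ^ (x₀ - 3 / 2) + u ^ (x₁ + 1 - 3 / 2)) * Real.exp (-(3 / 4 * u)) with hI₀
  have hI : 0 ≤ I₀ := setIntegral_stripMajorant_nonneg _ _
  have hA : (0 : ℝ) ≤ Real.pi ^ 2 * h ^ 2 := by positivity
  -- the two Mellin terms on the strip `x₀ ≤ re z ≤ x₁ + 1`
  have hm₁ : ‖mellin (fun t : ℝ => Complex.exp (-(t : ℂ) - ((Real.pi ^ 2 * h ^ 2 : ℝ) : ℂ) / (t : ℂ))) (s - 1 / 2)‖ ≤ I₀ * Real.exp (-(Real.pi * |h|)) := by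
    have hm := norm_mellin_expKernel_le (A := Real.pi ^ 2 * h ^ 2) (x₁ := x₁ + 1) hA hx₀ (z := s) h₀ (by linarith)
    rwa [sqrt_pi_sq_mul_sq] at hm
  have hm₂ : ‖mellin (fun t : ℝ => Complex.exp (-(t : ℂ) - ((Real.pi ^ 2 * h ^ 2 : ℝ) : ℂ) / (t : ℂ))) (s + 1 / 2)‖ ≤ I₀ * Real.exp (-(Real.pi * |h|)) := by
    have hre : (s + 1).re = s.re + 1 := by simp
    have hm := norm_mellin_expKernel_le (A := Real.pi ^ 2 * h ^ 2) (x₁ := x₁ + 1) hA hx₀ (z := s + 1) (by rw [hre]; linarith)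
      (by rw [hre]; linarith)
    rwa [sqrt_pi_sq_mul_sq, show (s + 1 - 1 / 2 : ℂ) = s + 1 / 2 by ring] at hm
  -- the bracket
  have hbr : ‖-(Real.pi * Complex.I * h) * mellin (fun t : ℝ => Complex.exp (-(t : ℂ) - ((Real.pi ^ 2 * h ^ 2 : ℝ) : ℂ) / (t : ℂ))) (s - 1 / 2) -
        Complex.I * mellin (fun t : ℝ => Complex.exp (-(t : ℂ) - ((Real.pi ^ 2 * h ^ 2 : ℝ) : ℂ) / (t : ℂ))) (s + 1 / 2)‖ ≤
      I₀ * (Real.pi * |h| + 1) * Real.exp (-(Real.pi * |h|)) := by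
    refine (norm_sub_le _ _).trans ?_
    rw [norm_mul, norm_mul, norm_neg, Complex.norm_I, one_mul]
    have hπh : ‖(Real.pi : ℂ) * Complex.I * (h : ℂ)‖ = Real.pi * |h| := by
      rw [norm_mul, norm_mul, Complex.norm_I, mul_one, Complex.norm_real, Complex.norm_real, Real.norm_of_nonneg Real.pi_pos.le,
        Real.norm_eq_abs]
    rw [hπh]
    have hπh0 : 0 ≤ Real.pi * |h| := by positivity
    calc Real.pi * |h| * ‖mellin (fun t : ℝ => Complex.exp (-(t : ℂ) - ((Real.pi ^ 2 * h ^ 2 : ℝ) : ℂ) / (t : ℂ))) (s - 1 / 2)‖ +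
          ‖mellin (fun t : ℝ => Complex.exp (-(t : ℂ) - ((Real.pi ^ 2 * h ^ 2 : ℝ) : ℂ) / (t : ℂ))) (s + 1 / 2)‖
        ≤ Real.pi * |h| * (I₀ * Real.exp (-(Real.pi * |h|))) + I₀ * Real.exp (-(Real.pi * |h|)) :=
          add_le_add (mul_le_mul_of_nonneg_left hm₁ hπh0) hm₂
      _ = I₀ * (Real.pi * |h| + 1) * Real.exp (-(Real.pi * |h|)) := by ring
  calc ‖(Complex.Gamma (s + 1))⁻¹ * ((Real.sqrt Real.pi : ℝ) : ℂ) *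
        (-(Real.pi * Complex.I * h) * mellin (fun t : ℝ => Complex.exp (-(t : ℂ) - ((Real.pi ^ 2 * h ^ 2 : ℝ) : ℂ) / (t : ℂ))) (s - 1 / 2) -
          Complex.I * mellin (fun t : ℝ => Complex.exp (-(t : ℂ) - ((Real.pi ^ 2 * h ^ 2 : ℝ) : ℂ) / (t : ℂ))) (s + 1 / 2))‖
      = ‖(Complex.Gamma (s + 1))⁻¹‖ * Real.sqrt Real.pi *
        ‖-(Real.pi * Complex.I * h) * mellin (fun t : ℝ => Complex.exp (-(t : ℂ) - ((Real.pi ^ 2 * h ^ 2 : ℝ) : ℂ) / (t : ℂ))) (s - 1 / 2) -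
          Complex.I * mellin (fun t : ℝ => Complex.exp (-(t : ℂ) - ((Real.pi ^ 2 * h ^ 2 : ℝ) : ℂ) / (t : ℂ))) (s + 1 / 2)‖ := by
        rw [norm_mul, norm_mul, Complex.norm_real, Real.norm_of_nonneg (Real.sqrt_nonneg _)]
    _ ≤ ‖(Complex.Gamma (s + 1))⁻¹‖ * Real.sqrt Real.pi * (I₀ * (Real.pi * |h| + 1) * Real.exp (-(Real.pi * |h|))) := by gcongr
    _ = _ := by ring

/-- **THE ARCHIMEDEAN LINE LETTER, LOCALLY UNIFORM IN `s`, RATE `π` EXPOSED**: for `re z₀ > ½` there are `C ≥ 0` and `r > 0` (`r = (re z₀ − ½)∕2`) with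
`‖Γ(s+1)⁻¹·√π·(−iπh·𝓜[K_h](s−½) − i·𝓜[K_h](s+½))‖ ≤ C·(1 + |h|)·e^{−π|h|}` for all `s` with `dist s z₀ < r` and ALL real `h`
(§1 strip bound on the closed disc; `Γ(s+1)⁻¹` bounded there, ★ `exists_forall_norm_Gamma_inv_le`). [cite: Bump1997, §1.6, §3.7] [cite: Garrett2018, §1.10] -/
theorem exists_forall_norm_archLineClosedForm_le {z₀ : ℂ} (hz₀ : 1 / 2 < z₀.re) :
    ∃ C r : ℝ, 0 ≤ C ∧ 0 < r ∧ ∀ s : ℂ, dist s z₀ < r → ∀ h : ℝ,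
      ‖(Complex.Gamma (s + 1))⁻¹ * ((Real.sqrt Real.pi : ℝ) : ℂ) *
          (-(Real.pi * Complex.I * h) * mellin (fun t : ℝ => Complex.exp (-(t : ℂ) - ((Real.pi ^ 2 * h ^ 2 : ℝ) : ℂ) / (t : ℂ))) (s - 1 / 2) -
            Complex.I * mellin (fun t : ℝ => Complex.exp (-(t : ℂ) - ((Real.pi ^ 2 * h ^ 2 : ℝ) : ℂ) / (t : ℂ))) (s + 1 / 2))‖ ≤
        C * (1 + |h|) * Real.exp (-(Real.pi * |h|)) := by
  set r : ℝ := (z₀.re - 1 / 2) / 2 with hr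
  have hr0 : 0 < r := by rw [hr]; linarith
  have hx₀ : 1 / 2 < z₀.re - r := by rw [hr]; linarith
  -- `Γ(s+1)⁻¹` on the closed disc `B̄(z₀ + 1, r)`
  obtain ⟨CΓ, hCΓ0, hCΓ⟩ := exists_forall_norm_Gamma_inv_le (isCompact_closedBall (z₀ + 1) r)
  set I₀ : ℝ := ∫ u in Ioi (0 : ℝ), (u ^ (z₀.re - r - 3 / 2) + u ^ (z₀.re + r + 1 - 3 / 2)) * Real.exp (-(3 / 4 * u)) with hI₀
  have hI : 0 ≤ I₀ := setIntegral_stripMajorant_nonneg _ _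
  refine ⟨CΓ * Real.sqrt Real.pi * I₀ * (Real.pi + 1), r, by positivity, hr0, fun s hs h => ?_⟩
  have hs' : s ∈ Metric.closedBall z₀ r := Metric.mem_closedBall.2 (le_of_lt hs)
  obtain ⟨h₀, h₁⟩ := re_mem_Icc_of_mem_closedBall hs'
  have hΓ : ‖(Complex.Gamma (s + 1))⁻¹‖ ≤ CΓ := hCΓ (s + 1) (by
    rw [Metric.mem_closedBall, dist_eq_norm, show s + 1 - (z₀ + 1) = s - z₀ by ring, ← dist_eq_norm]; exact le_of_lt hs)
  have habs : 0 ≤ |h| := abs_nonneg h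
  have hpoly : Real.pi * |h| + 1 ≤ (Real.pi + 1) * (1 + |h|) := by nlinarith [Real.pi_pos, habs]
  calc _ ≤ ‖(Complex.Gamma (s + 1))⁻¹‖ * Real.sqrt Real.pi * I₀ * (Real.pi * |h| + 1) * Real.exp (-(Real.pi * |h|)) :=
        norm_archLineClosedForm_le_of_re_mem_Icc hx₀ h₀ h₁ h
    _ ≤ CΓ * Real.sqrt Real.pi * I₀ * ((Real.pi + 1) * (1 + |h|)) * Real.exp (-(Real.pi * |h|)) := by gcongr
    _ = CΓ * Real.sqrt Real.pi * I₀ * (Real.pi + 1) * (1 + |h|) * Real.exp (-(Real.pi * |h|)) := by ring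

/-- **THE SCALAR-TYPE LINE WHITTAKER INTEGRAL ITSELF**: for `re z₀ > ½` there are `C ≥ 0`, `r > 0` with
`‖∫_ℝ f⁰_{s,1}(J·n(β)) e^{−2πihβ} dβ‖ ≤ C·(1 + |h|)·e^{−π|h|}` for all `s` with `dist s z₀ < r` and ALL real `h` (★ W1-arch `archLineWhittaker_eq` puts the
integral in closed form on `re s > ½`, which holds on the disc of radius `≤ (re z₀ − ½)∕2`; then §1). [cite: Bump1997, §1.6, §3.7] -/
theorem exists_forall_norm_archLineWhittaker_le {z₀ : ℂ} (hz₀ : 1 / 2 < z₀.re) :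
    ∃ C r : ℝ, 0 ≤ C ∧ 0 < r ∧ ∀ s : ℂ, dist s z₀ < r → ∀ h : ℝ,
      ‖∫ β : ℝ, archScalarSection 1 s (Matrix.J (Fin 1) ℂ * Matrix.fromBlocks 1 ((β : ℂ) • (1 : Matrix (Fin 1) (Fin 1) ℂ)) 0 1) *
          Complex.exp (-(2 * Real.pi * Complex.I * h * β))‖ ≤ C * (1 + |h|) * Real.exp (-(Real.pi * |h|)) := by
  obtain ⟨C, r, hC, hr, hb⟩ := exists_forall_norm_archLineClosedForm_le hz₀
  refine ⟨C, min r ((z₀.re - 1 / 2) / 2), hC, lt_min hr (by linarith), fun s hs h => ?_⟩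
  have hsr : dist s z₀ < r := lt_of_lt_of_le hs (min_le_left _ _)
  have hs2 : 1 / 2 < s.re := by
    have h1 : dist s z₀ < (z₀.re - 1 / 2) / 2 := lt_of_lt_of_le hs (min_le_right _ _)
    obtain ⟨h₀, -⟩ := re_mem_Icc_of_mem_closedBall (Metric.mem_closedBall.2 h1.le)
    linarith
  rw [archLineWhittaker_eq hs2 h]
  exact hb s hsr h

/-- **THE MIRROR LINE TYPE `k = −1`**: the same letter for `∫_ℝ f⁰_{s,−1}(J·n(β)) e^{−2πihβ} dβ` (★ `whittaker_neg_weight_eq_conj`: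
`W^{(−1)}_h(s) = conj W^{(1)}_{−h}(conj s)`, and `re (conj s) = re s`, `|−h| = |h|`; §1 at `conj z₀`). [cite: Bump1997, §1.6, §3.7] -/
theorem exists_forall_norm_archLineWhittaker_neg_le {z₀ : ℂ} (hz₀ : 1 / 2 < z₀.re) :
    ∃ C r : ℝ, 0 ≤ C ∧ 0 < r ∧ ∀ s : ℂ, dist s z₀ < r → ∀ h : ℝ,
      ‖∫ β : ℝ, archScalarSection (-1) s (Matrix.J (Fin 1) ℂ * Matrix.fromBlocks 1 ((β : ℂ) • (1 : Matrix (Fin 1) (Fin 1) ℂ)) 0 1) *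
          Complex.exp (-(2 * Real.pi * Complex.I * h * β))‖ ≤ C * (1 + |h|) * Real.exp (-(Real.pi * |h|)) := by
  have hz₀' : 1 / 2 < (conj z₀).re := by rwa [Complex.conj_re]
  obtain ⟨C, r, hC, hr, hb⟩ := exists_forall_norm_archLineWhittaker_le hz₀'
  refine ⟨C, r, hC, hr, fun s hs h => ?_⟩
  have hs' : dist (conj s) (conj z₀) < r := by rwa [Complex.dist_conj_conj]
  have h1 := hb (conj s) hs' (-h)
  rw [abs_neg] at h1
  rw [show (-1 : ℤ) = -(1 : ℤ) from rfl, whittaker_neg_weight_eq_conj, Complex.norm_conj]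
  exact h1

/-- **ODD TYPES `k = 2j+1`, THE EVEN INTEGRALS BY VALUE**: near `z₀` (`re z₀ > ½`),
`‖∫_ℝ f⁰_{s,2j+1}(J·n(β)) e^{−2πihβ} dβ‖ ≤ C·(1+|h|)·e^{−π|h|} + 2·Σ_{m<j} ‖V_{m+1}(s,h)‖`, `V_m(s,h) = ∫_ℝ (β−i)^{2m}(1+β²)^{−s−m−1}e^{−2πihβ} dβ`
(★ `oddWhittaker_closedForm`: `W^{(2j+1)} = CF − 2iΣ V_{m+1}` on `re s > ½`; §1 for `CF`).  The `h`-decay of the `V_m` is NOT claimed here (edition 2, only if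
the family's archimedean type has `|k| ≥ 3`). [cite: Bump1997, §1.6, §3.7] -/
theorem exists_forall_norm_oddWhittaker_le (j : ℕ) {z₀ : ℂ} (hz₀ : 1 / 2 < z₀.re) :
    ∃ C r : ℝ, 0 ≤ C ∧ 0 < r ∧ ∀ s : ℂ, dist s z₀ < r → ∀ h : ℝ,
      ‖∫ β : ℝ, archScalarSection (2 * (j : ℤ) + 1) s (Matrix.J (Fin 1) ℂ * Matrix.fromBlocks 1 ((β : ℂ) • (1 : Matrix (Fin 1) (Fin 1) ℂ)) 0 1) *
          Complex.exp (-(2 * Real.pi * Complex.I * h * β))‖ ≤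
        C * (1 + |h|) * Real.exp (-(Real.pi * |h|)) +
          2 * ∑ m ∈ Finset.range j, ‖∫ β : ℝ, ((β : ℂ) - Complex.I) ^ (2 * (m + 1)) * (((1 + β ^ 2 : ℝ)) : ℂ) ^ (-s - ((m + 1 : ℕ) : ℂ) - 1) *
            Complex.exp (-(2 * Real.pi * Complex.I * h * β))‖ := by
  obtain ⟨C, r, hC, hr, hb⟩ := exists_forall_norm_archLineClosedForm_le hz₀
  refine ⟨C, min r ((z₀.re - 1 / 2) / 2), hC, lt_min hr (by linarith), fun s hs h => ?_⟩
  have hsr : dist s z₀ < r := lt_of_lt_of_le hs (min_le_left _ _)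
  have hs2 : 1 / 2 < s.re := by
    have h1 : dist s z₀ < (z₀.re - 1 / 2) / 2 := lt_of_lt_of_le hs (min_le_right _ _)
    obtain ⟨h₀, -⟩ := re_mem_Icc_of_mem_closedBall (Metric.mem_closedBall.2 h1.le)
    linarith
  rw [oddWhittaker_closedForm j hs2 h]
  refine (norm_sub_le _ _).trans (add_le_add (hb s hsr h) ?_)
  rw [norm_mul, norm_mul, Complex.norm_two, Complex.norm_I, mul_one]
  exact mul_le_mul_of_nonneg_left (norm_sum_le _ _) zero_le_two

/-- **MIRROR ODD TYPES `k = −(2j+1)`, THE EVEN INTEGRALS BY VALUE** (★ `whittaker_neg_weight_eq_conj` + the previous letter at `conj z₀`, `−h`).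
[cite: Bump1997, §1.6, §3.7] -/
theorem exists_forall_norm_oddWhittaker_neg_le (j : ℕ) {z₀ : ℂ} (hz₀ : 1 / 2 < z₀.re) :
    ∃ C r : ℝ, 0 ≤ C ∧ 0 < r ∧ ∀ s : ℂ, dist s z₀ < r → ∀ h : ℝ,
      ‖∫ β : ℝ, archScalarSection (-(2 * (j : ℤ) + 1)) s (Matrix.J (Fin 1) ℂ * Matrix.fromBlocks 1 ((β : ℂ) • (1 : Matrix (Fin 1) (Fin 1) ℂ)) 0 1) *
          Complex.exp (-(2 * Real.pi * Complex.I * h * β))‖ ≤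
        C * (1 + |h|) * Real.exp (-(Real.pi * |h|)) +
          2 * ∑ m ∈ Finset.range j, ‖∫ β : ℝ, ((β : ℂ) - Complex.I) ^ (2 * (m + 1)) * (((1 + β ^ 2 : ℝ)) : ℂ) ^ (-conj s - ((m + 1 : ℕ) : ℂ) - 1) *
            Complex.exp (-(2 * Real.pi * Complex.I * ((-h : ℝ) : ℂ) * β))‖ := by
  have hz₀' : 1 / 2 < (conj z₀).re := by rwa [Complex.conj_re]
  obtain ⟨C, r, hC, hr, hb⟩ := exists_forall_norm_oddWhittaker_le j hz₀'
  refine ⟨C, r, hC, hr, fun s hs h => ?_⟩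
  have hs' : dist (conj s) (conj z₀) < r := by rwa [Complex.dist_conj_conj]
  have h1 := hb (conj s) hs' (-h)
  rw [abs_neg] at h1
  rw [whittaker_neg_weight_eq_conj, Complex.norm_conj]
  exact h1

end ArchLine

/-! ## §2 The `n = 1` height face (★ `decay_le_exp_neg_height_of_le` READ at block type `p := Fin 1`, scalar currency) -/

section HeightFace

open scoped ComplexOrder Matrix
open NumberField NumberField.mixedEmbedding NumberField.InfinitePlace IsDedekindDomain
open Literature.NumberTheory.Automorphic Literature.NumberTheory.Automorphic.UnitaryGroup
open Summit.HodgeConjecture.HodgeConjecture.Cruxes.HLiu418.K2LiuSiegelEisensteinKindWArchDecay (decay_le_exp_neg_height_of_le)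
open Summit.HodgeConjecture.HodgeConjecture.Cruxes.HLiu418.K2LiuArchBlockHeightBound (norm_archAt_archPart_apply_le)
open Summit.HodgeConjecture.HodgeConjecture.Cruxes.HLiu418.K2LiuIwasawaHeightLatticeSumBound (block_entry_bounds exists_adelicHeightGL_floor)

variable (F E : Type) [Field F] [NumberField F] [Field E] [NumberField E] [Algebra F E] (c : E ≃ₐ[F] E) (N : ℕ) (J : Matrix (Fin N) (Fin N) E)
variable {S : Type*} [Fintype S]

omit [Fintype S] in
/-- 1×1 bookkeeping: `Re tr(diag(t) · y yᴴ) = t · ‖y₀₀‖²` for real `t` and `y ∈ M_1(ℂ)`. [folklore] -/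
theorem re_trace_diagonal_mul_mul_conjTranspose (t : ℝ) (y : Matrix (Fin 1) (Fin 1) ℂ) :
    ((Matrix.diagonal (fun _ : Fin 1 => (t : ℂ)) * (y * yᴴ)).trace).re = t * ‖y 0 0‖ ^ 2 := by
  rw [Matrix.trace_fin_one, Matrix.mul_apply, Fin.sum_univ_one, Matrix.diagonal_apply_eq, Matrix.mul_apply, Fin.sum_univ_one,
    Matrix.conjTranspose_apply, Complex.star_def, Complex.mul_conj, Complex.normSq_eq_norm_sq, ← Complex.ofReal_mul, Complex.ofReal_re]

omit [Fintype S] in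
/-- 1×1 bookkeeping: `Re tr diag(t) = t`. [folklore] -/
theorem re_trace_diagonal_fin_one (t : ℝ) : ((Matrix.diagonal (fun _ : Fin 1 => (t : ℂ))).trace).re = t := by
  rw [Matrix.trace_fin_one, Matrix.diagonal_apply_eq, Complex.ofReal_re]

/-- **THE `n = 1` HEIGHT FACE (exponential)**.  Frame data BY VALUE as in ★ G7-C ∕ ★ `decay_le_exp_neg_height`: `H₁ = U(J)` with `J ∈ M_N(E)` and
`r : Fin 1 ⊕ Fin 1 ≃ Fin N` (so `N = 2`), complex places `w σ` fixed by `c ≠ 1`, frames `T σ, T σ⁻¹` and one bound `M ≥ 1` for the entries of the frames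
and the movers.  CONCLUSION: `∃ c₁ > 0` (frame data only) such that for every `h`, all movers, EVERY Iwasawa block decomposition
`T σ · (h_∞)~_{w σ} · T σ⁻¹ = [y σ, b σ; 0, d σ] · κ σ` (1×1 blocks) and all reals `t σ ≥ 0` (read `t σ = ½|μ|_σ`, the normalised line index):
`∏_σ e^{−2π t_σ ‖y_σ‖²} ≤ e^{−c₁ ‖h‖^{−2} τ}` for every `τ ≤ Σ_σ t_σ` (★ `decay_le_exp_neg_height_of_le` at `p := Fin 1`, `x σ := diag(t σ)`).
[cite: MoeglinWaldspurger1995, I.2.2, II.1.5] [cite: BorelJacquet1979, §1.2, §4.1] [cite: Shimura1997, §A3] -/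
theorem lineDecay_le_exp_neg_height [NeZero N] (hc : c ≠ 1) (w : S → {w : InfinitePlace E // IsComplex w}) (hw : ∀ σ, c • (w σ).1 = (w σ).1)
    (r : Fin 1 ⊕ Fin 1 ≃ Fin N) (T Tinv : S → Matrix (Fin 1 ⊕ Fin 1) (Fin 1 ⊕ Fin 1) ℂ) (hT : ∀ σ, T σ * Tinv σ = 1) (hT' : ∀ σ, Tinv σ * T σ = 1)
    {M : ℝ} (hM : 1 ≤ M) (hTe : ∀ σ i j, ‖T σ i j‖ ≤ M) (hTe' : ∀ σ i j, ‖Tinv σ i j‖ ≤ M) :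
    ∃ c₁ : ℝ, 0 < c₁ ∧ ∀ (h : (adelicGroupData F E c N J).Adelic) (y b d : S → Matrix (Fin 1) (Fin 1) ℂ)
      (κ κ' : S → Matrix (Fin 1 ⊕ Fin 1) (Fin 1 ⊕ Fin 1) ℂ),
      (∀ σ, κ σ * κ' σ = 1) → (∀ σ, κ' σ * κ σ = 1) → (∀ σ i j, ‖κ σ i j‖ ≤ M) → (∀ σ i j, ‖κ' σ i j‖ ≤ M) →
      (∀ σ, T σ * Matrix.reindex r.symm r.symm
          ((((archAt F E c N J (w σ) (hw σ) hc (archPart F E c N J h) : archLocal E N J (w σ)) : GL (Fin N) ℂ) : Matrix (Fin N) (Fin N) ℂ)) *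
          Tinv σ = Matrix.fromBlocks (y σ) (b σ) 0 (d σ) * κ σ) →
      ∀ t : S → ℝ, (∀ σ, 0 ≤ t σ) → ∀ τ : ℝ, τ ≤ ∑ σ, t σ →
        ∏ σ, Real.exp (-(2 * Real.pi * (t σ * ‖y σ 0 0‖ ^ 2))) ≤
          Real.exp (-(c₁ * adelicHeightGL N E (adelicVal F E c N J h) ^ (-(2 : ℝ)) * τ)) := by
  obtain ⟨c₁, hc₁, hface⟩ := decay_le_exp_neg_height_of_le F E c N J hc w hw r T Tinv hT hT' hM hTe hTe'
  refine ⟨c₁, hc₁, fun h y b d κ κ' hκ hκ' hκe hκe' hdec t ht τ hτ => ?_⟩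
  have hx : ∀ σ, (Matrix.diagonal (fun _ : Fin 1 => ((t σ : ℝ) : ℂ))).PosSemidef := fun σ =>
    Matrix.posSemidef_diagonal_iff.2 fun _ => Complex.zero_le_real.2 (ht σ)
  have hτ' : τ ≤ ∑ σ, ((Matrix.diagonal (fun _ : Fin 1 => ((t σ : ℝ) : ℂ))).trace).re := by
    simpa only [re_trace_diagonal_fin_one] using hτ
  have key := hface h y b d κ κ' hκ hκ' hκe hκe' hdec (fun σ => Matrix.diagonal fun _ : Fin 1 => ((t σ : ℝ) : ℂ)) hx τ hτ'
  have hprod : ∏ σ, Real.exp (-(2 * Real.pi * ((Matrix.diagonal (fun _ : Fin 1 => ((t σ : ℝ) : ℂ)) * (y σ * (y σ)ᴴ)).trace).re)) =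
      ∏ σ, Real.exp (-(2 * Real.pi * (t σ * ‖y σ 0 0‖ ^ 2))) :=
    Finset.prod_congr rfl fun σ _ => by rw [re_trace_diagonal_mul_mul_conjTranspose]
  rw [hprod] at key
  exact key

/-- **THE `n = 1` HEIGHT FACE (polynomial)**.  Same frame data; CONCLUSION: `∃ C₂ > 0` (frame data only) such that for every `h`, all movers, every
Iwasawa block decomposition (1×1 blocks), all `t σ ≥ 0` and every `k : ℕ`:
`∏_σ (1 + t_σ ‖y_σ‖²)^k ≤ C₂^k · ‖h‖^{2·#S·k} · (1 + Σ_σ t_σ)^{#S·k}` (★ G7-B `block_entry_bounds`: `‖y_σ‖ ≤ c_B ‖h‖`; the height floor ★ `exists_adelicHeightGL_floor`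
turns `1 + c_B² ‖h‖²` into `(c₀⁻² + c_B²) ‖h‖²`). [cite: MoeglinWaldspurger1995, I.2.2, II.1.5] [cite: BorelJacquet1979, §1.2, §4.1] -/
theorem prod_one_add_mul_normSq_pow_le_height [NeZero N] (hc : c ≠ 1) (w : S → {w : InfinitePlace E // IsComplex w}) (hw : ∀ σ, c • (w σ).1 = (w σ).1)
    (r : Fin 1 ⊕ Fin 1 ≃ Fin N) (T Tinv : S → Matrix (Fin 1 ⊕ Fin 1) (Fin 1 ⊕ Fin 1) ℂ) (hT : ∀ σ, T σ * Tinv σ = 1) (hT' : ∀ σ, Tinv σ * T σ = 1)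
    {M : ℝ} (hM : 1 ≤ M) (hTe : ∀ σ i j, ‖T σ i j‖ ≤ M) (hTe' : ∀ σ i j, ‖Tinv σ i j‖ ≤ M) :
    ∃ C₂ : ℝ, 0 < C₂ ∧ ∀ (h : (adelicGroupData F E c N J).Adelic) (y b d : S → Matrix (Fin 1) (Fin 1) ℂ)
      (κ κ' : S → Matrix (Fin 1 ⊕ Fin 1) (Fin 1 ⊕ Fin 1) ℂ),
      (∀ σ, κ σ * κ' σ = 1) → (∀ σ, κ' σ * κ σ = 1) → (∀ σ i j, ‖κ σ i j‖ ≤ M) → (∀ σ i j, ‖κ' σ i j‖ ≤ M) →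
      (∀ σ, T σ * Matrix.reindex r.symm r.symm
          ((((archAt F E c N J (w σ) (hw σ) hc (archPart F E c N J h) : archLocal E N J (w σ)) : GL (Fin N) ℂ) : Matrix (Fin N) (Fin N) ℂ)) *
          Tinv σ = Matrix.fromBlocks (y σ) (b σ) 0 (d σ) * κ σ) →
      ∀ t : S → ℝ, (∀ σ, 0 ≤ t σ) → ∀ k : ℕ,
        ∏ σ, (1 + t σ * ‖y σ 0 0‖ ^ 2) ^ k ≤
          C₂ ^ k * adelicHeightGL N E (adelicVal F E c N J h) ^ (((2 * Fintype.card S * k : ℕ)) : ℝ) * (1 + ∑ σ, t σ) ^ (Fintype.card S * k) := by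
  obtain ⟨c₀, hc₀, hfloor⟩ := exists_adelicHeightGL_floor E N
  set cB : ℝ := (Fintype.card (Fin 1 ⊕ Fin 1) : ℝ) ^ 3 * M ^ 3 with hcB
  have hcB0 : 0 ≤ cB := by positivity
  set K : ℝ := (c₀ ^ 2)⁻¹ + cB ^ 2 with hK
  have hK0 : 0 < K := by positivity
  refine ⟨K ^ Fintype.card S, pow_pos hK0 _, fun h y b d κ κ' hκ hκ' hκe hκe' hdec t ht k => ?_⟩
  set H : ℝ := adelicHeightGL N E (adelicVal F E c N J h) with hH
  have hHc : c₀ ≤ H := hfloor _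
  have hH0 : 0 < H := lt_of_lt_of_le hc₀ hHc
  have hM0 : 0 ≤ M := zero_le_one.trans hM
  have hsum0 : 0 ≤ ∑ σ, t σ := Finset.sum_nonneg fun σ _ => ht σ
  -- per place: `‖y σ 0 0‖ ≤ cB · H`
  have hy : ∀ σ, ‖y σ 0 0‖ ≤ cB * H := fun σ => by
    have hg := norm_archAt_archPart_apply_le F E c N J (w σ) (hw σ) hc h
    have hmul : ((((archAt F E c N J (w σ) (hw σ) hc (archPart F E c N J h) : archLocal E N J (w σ)) : GL (Fin N) ℂ) : Matrix (Fin N) (Fin N) ℂ)) *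
        ((((archAt F E c N J (w σ) (hw σ) hc (archPart F E c N J h))⁻¹ : archLocal E N J (w σ)) : GL (Fin N) ℂ) : Matrix (Fin N) (Fin N) ℂ) = 1 := by
      rw [Subgroup.coe_inv, Matrix.coe_units_inv, Matrix.mul_nonsing_inv _ (Matrix.isUnits_det_units _)]
    exact (block_entry_bounds r (hT σ) (hT' σ) (hκ σ) (hκ' σ) hM0 (hTe σ) (hTe' σ) (hκe σ) (hκe' σ) hmul hH0.le
      (fun i j => (hg i j).1) (fun i j => (hg i j).2) (hdec σ)).1 0 0
  -- per place: `1 + t ‖y‖² ≤ K H² (1 + Σ t)`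
  have hKH : 1 + cB ^ 2 * H ^ 2 ≤ K * H ^ 2 := by
    have h1 : 1 ≤ (c₀ ^ 2)⁻¹ * H ^ 2 := by
      rw [inv_mul_eq_div, le_div_iff₀ (by positivity)]
      nlinarith [mul_nonneg hc₀.le hH0.le]
    rw [hK]; nlinarith
  have hplace : ∀ σ, 1 + t σ * ‖y σ 0 0‖ ^ 2 ≤ K * H ^ 2 * (1 + ∑ σ', t σ') := fun σ => by
    have hty : t σ * ‖y σ 0 0‖ ^ 2 ≤ t σ * (cB * H) ^ 2 :=
      mul_le_mul_of_nonneg_left (pow_le_pow_left₀ (norm_nonneg _) (hy σ) 2) (ht σ)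
    have htσ : t σ ≤ ∑ σ', t σ' := Finset.single_le_sum (fun σ' _ => ht σ') (Finset.mem_univ σ)
    have h2 : 1 + t σ * (cB * H) ^ 2 ≤ (1 + cB ^ 2 * H ^ 2) * (1 + t σ) := by nlinarith [ht σ, sq_nonneg (cB * H)]
    calc 1 + t σ * ‖y σ 0 0‖ ^ 2 ≤ 1 + t σ * (cB * H) ^ 2 := by linarith
      _ ≤ (1 + cB ^ 2 * H ^ 2) * (1 + t σ) := h2
      _ ≤ K * H ^ 2 * (1 + ∑ σ', t σ') := mul_le_mul hKH (by linarith) (by linarith [ht σ]) (mul_nonneg hK0.le (sq_nonneg _))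
  have hplace0 : ∀ σ, 0 ≤ 1 + t σ * ‖y σ 0 0‖ ^ 2 := fun σ => add_nonneg zero_le_one (mul_nonneg (ht σ) (sq_nonneg _))
  -- product and power
  have hprod : ∏ σ, (1 + t σ * ‖y σ 0 0‖ ^ 2) ≤ (K * H ^ 2 * (1 + ∑ σ', t σ')) ^ Fintype.card S := by
    calc ∏ σ, (1 + t σ * ‖y σ 0 0‖ ^ 2) ≤ ∏ _σ : S, K * H ^ 2 * (1 + ∑ σ', t σ') :=
          Finset.prod_le_prod (fun σ _ => hplace0 σ) fun σ _ => hplace σ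
      _ = (K * H ^ 2 * (1 + ∑ σ', t σ')) ^ Fintype.card S := by rw [Finset.prod_const, Finset.card_univ]
  calc ∏ σ, (1 + t σ * ‖y σ 0 0‖ ^ 2) ^ k = (∏ σ, (1 + t σ * ‖y σ 0 0‖ ^ 2)) ^ k := Finset.prod_pow _ _ _
    _ ≤ ((K * H ^ 2 * (1 + ∑ σ', t σ')) ^ Fintype.card S) ^ k :=
        pow_le_pow_left₀ (Finset.prod_nonneg fun σ _ => hplace0 σ) hprod k
    _ = (K ^ Fintype.card S) ^ k * H ^ (((2 * Fintype.card S * k : ℕ)) : ℝ) * (1 + ∑ σ, t σ) ^ (Fintype.card S * k) := by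
        have e1 : ((K * H ^ 2 * (1 + ∑ σ', t σ')) ^ Fintype.card S) ^ k =
            K ^ (Fintype.card S * k) * (H ^ 2) ^ (Fintype.card S * k) * (1 + ∑ σ', t σ') ^ (Fintype.card S * k) := by
          rw [← pow_mul, mul_pow, mul_pow]
        have e2 : (H ^ 2) ^ (Fintype.card S * k) = H ^ (2 * Fintype.card S * k) := by rw [← pow_mul, mul_assoc]
        rw [Real.rpow_natCast, e1, e2, pow_mul K (Fintype.card S) k]

end HeightFace

/-! ## §3 `hdec₁_of_letters` (★ `hdec_of_letters` READ at `n := 1`) -/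

section Dec

open scoped NNReal
-- `Classical` is needed to see the Mathlib normed-ring instances on `mixedSpace L` (note H5 of ★ `AdelicGLnGlue`; as ★ `hdec_of_letters`)
open scoped Classical
open NumberField NumberField.mixedEmbedding NumberField.InfinitePlace IsDedekindDomain
open Literature.NumberTheory.Automorphic
open Summit.HodgeConjecture.HodgeConjecture.Cruxes.HLiu418.K2LiuSiegelEisensteinKindWDecay (hdec_of_letters)

variable (L : Type) [Field L] [NumberField L] {N : ℕ} [NeZero N]

/-- **`hdec₁` OF THE KIND-1 BLOCK FROM LOCAL LETTERS** — ★ `K2LiuSiegelEisensteinKindWDecay.hdec_of_letters` READ at `n := 1` (generic index type `ι`, read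
the rank-one Fourier indices as 1×1 matrices `mat i`, and point type `X`, read `H₁(𝔸)`, `ht := (↑)`, `N := 1 + 1`).  For 1×1 indices the determinant IS the
entry: the archimedean defect of the local letter reads `∏_{w∣∞} (1 + |mat i 0 0|_w⁻¹)^{N′}` and the degeneracy letter reads `mat i 0 0 = 0 → A i s x = 0`.
With the size `τ` (`hτ`), the support letter `hsupp` ((KW1-c) shape) and a local decay letter of the TOP's shape TIMES the defect (`hloc`):
`∃ N_W, ∀ z, 0 < re z → ∃ C a c a′ r, … ∀ i s, dist s z < r → ∀ x, ‖A i s x‖ ≤ C ‖ht x‖^a · (e^{−c ‖ht x‖^{−a′} τ i} (1 + τ i)^{N_W})`.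
[cite: MoeglinWaldspurger1995, II.1.7, IV.1.9] [cite: Shimura1997, §18.4 Prop. 18.14] [cite: BorelJacquet1979, §1.2] -/
theorem hdec₁_of_letters {ι X : Type*} (mat : ι → Matrix (Fin 1) (Fin 1) L) (ht : X → GL (Fin N) (AdeleRing (𝓞 L) L)) (A : ι → ℂ → X → ℂ)
    (τ : ι → ℝ) (hτ : ∀ i, ‖fun a b => mixedEmbedding L (mat i a b)‖ ≤ τ i)
    (hzero : ∀ (i : ι) (s : ℂ) (x : X), mat i 0 0 = 0 → A i s x = 0)
    {CW κ : ℝ} (hCW : 0 < CW) (hκ : 0 ≤ κ)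
    (hsupp : ∀ (i : ι) (s : ℂ) (x : X), 0 < s.re → A i s x ≠ 0 →
      ∃ D : ℕ, 1 ≤ D ∧ (D : ℝ) ≤ CW * adelicHeightGL N L (ht x) ^ κ ∧ ∀ a b, IsIntegral ℤ ((D : L) * mat i a b))
    (N₁ N' : ℕ)
    (hloc : ∀ z : ℂ, 0 < z.re → ∃ C a c a' r : ℝ, 0 ≤ C ∧ 0 ≤ a ∧ 0 < c ∧ 0 ≤ a' ∧ 0 < r ∧ ∀ (i : ι) (s : ℂ), dist s z < r → ∀ x : X,
      ‖A i s x‖ ≤ C * adelicHeightGL N L (ht x) ^ a *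
        (Real.exp (-(c * adelicHeightGL N L (ht x) ^ (-a') * τ i)) * (1 + τ i) ^ N₁) * ∏ w : InfinitePlace L, (1 + (w (mat i 0 0))⁻¹) ^ N') :
    ∃ NW : ℕ, ∀ z : ℂ, 0 < z.re → ∃ C a c a' r : ℝ, 0 ≤ C ∧ 0 ≤ a ∧ 0 < c ∧ 0 ≤ a' ∧ 0 < r ∧ ∀ (i : ι) (s : ℂ), dist s z < r → ∀ x : X,
      ‖A i s x‖ ≤ C * adelicHeightGL N L (ht x) ^ a *
        (Real.exp (-(c * adelicHeightGL N L (ht x) ^ (-a') * τ i)) * (1 + τ i) ^ NW) := by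
  have hdet : ∀ i, (mat i).det = mat i 0 0 := fun i => Matrix.det_fin_one _
  refine hdec_of_letters L mat ht A τ hτ (fun i s x h => hzero i s x (by rwa [hdet] at h)) hCW hκ hsupp N₁ N' fun z hz => ?_
  obtain ⟨C, a, c, a', r, hC, ha, hc, ha', hr, hb⟩ := hloc z hz
  exact ⟨C, a, c, a', r, hC, ha, hc, ha', hr, fun i s hs x => by rw [hdet]; exact hb i s hs x⟩

end Dec

end Summit.HodgeConjecture.HodgeConjecture.Cruxes.HLiu418.K2LiuKindOneLineWhittakerDecay

end
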